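import Summits.QuantumFields.YangMills.Theorems.PoincareLipschitzHSystemGapAlgebraLetters
import HarnessLib

/-!
# Crux `BlockLipschitzL` (stmt-QuantumFields-23533) ∕ `HistoryTailL` (stmt-QuantumFields-19936), LINE 25 «CompactnessTransfer»,
# stub S1″ — the (GAP) socket, ROAD (W) «Wente at 3π», brick (W-ALG) «THE H-SYSTEM GAP FROM THE TWO ANALYTIC ROWS»

Cell `ym3-torus` (YM ladder rung R3 = continuum SU(2) Yang–Mills on T³ — a RUNG, NOT Clay: not d = 4, not infinite volume,
not a mass gap); WIDTH helper seat `ym-ust-19936-w3` g16; `--supports stmt-QuantumFields-23533`; THEOREMS ONLY (0 `def`,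
0 `sorry`, default heartbeats); imports FILE 1∕2 (letters) + Mathlib only.

THE POINT.  px3 g9's cap ✓`…CentralDensityCapHolds.centralDensity_le_three_pi_holds` says every minimizing tangent map `ℝ³ → S³`
has density `Θ ≤ 3π`; px19 g8's ROAD (H) turns the link of such a map into a finite-energy weak solution `B : ℝ² → ℝ³` of the
`H`-system `ΔB = 2 B_x ∧ B_y` with `∫|∇B|² = Θ`, and closes the (GAP) through the named fact `HSystemEnergyQuantization`
[Brezis–Coron 1985, Lemma A.1: `∫|∇B|² ∈ 8πℕ`].  ROAD (W) (memo `ROAD-W-WENTE-3PI-w3g16.md`, 23533 evidence) replaces that named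
fact by the ELEMENTARY gap `∫|∇B|² ≤ 3π ⇒ ∫|∇B|² = 0`, proved from two analytic rows — (W-OSC) the SHARP TWO-POINT WENTE
oscillation bound `‖B^a − c_a‖_∞ ≤ (1∕2π)‖∇B^{a+1}‖₂‖∇B^{a+2}‖₂` and (W-EN) the energy identity
`∫|∇B|² ≤ 2 Σ_a |∫ (B^a − c_a)·det(∇B^{a+1}, ∇B^{a+2})|` — by the cubic chain
`Θ ≤ (1∕π) Σ_{pairs} ‖∇B^j‖₂²‖∇B^k‖₂² ≤ Θ²∕(3π)` (Hadamard + Cauchy–Schwarz + AM–GM), which gives `Θ ∈ {0} ∪ [3π, ∞)`, and the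
EQUALITY CASE at `Θ = 3π`: equality forces `‖∇B⁰‖₂ = ‖∇B¹‖₂ = ‖∇B²‖₂`, `|∇B^j| = |∇B^k|` a.e. and `∇B^j ⊥ ∇B^k` a.e. for all
three pairs — three pairwise-orthogonal vectors of equal length in `ℝ²` vanish, so `∇B = 0` a.e., contradiction.  THIS FILE IS
THAT ALGEBRAIC KNIT (W-ALG): it takes the two rows as hypotheses (real-analysis statements about `B`, `GB` on `ℝ²`) and proves
`∫ Σ_k ‖GB e_k‖² ≤ 3π → ∫ Σ_k ‖GB e_k‖² = 0`.  The rows themselves are bricks (W-TWO) and (W-EN) of the road (other pens).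

WHAT THIS FILE PROVES (letters: `E² = EuclideanSpace ℝ (Fin 2)`, `E³ = EuclideanSpace ℝ (Fin 3)`, `e k = EuclideanSpace.single k 1`,
`∂_k B^a := (GB y (e k)) a`, `f_a := ∂₀B^{a+1} ∂₁B^{a+2} − ∂₀B^{a+2} ∂₁B^{a+1}` = the RHS density of the weak `H`-system row of
`Literature.Analysis.PDE.HSystemEnergyQuantization`, indices in `Fin 3`):
* (letters — pointwise algebra in `ℝ²`, Cauchy–Schwarz, the component∕energy∕Jacobian-density letters and the two a.e. equality
  cases — are FILE 1∕2 ✓`…PoincareLipschitzHSystemGapAlgebraLetters`, imported.)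
* §4 ★★`chain_endgame` — the real-number endgame of the cubic chain (`Θ = 0`, or `Θ = 3π` with equality throughout) — and
  ★★★`energy_zero_of_osc_of_energyBound` — (W-ALG): from measurability of `B, GB`, integrability of `Σ_k‖GB e_k‖²`, the
  oscillation row (W-OSC) with constants `c : Fin 3 → ℝ` and the energy row (W-EN), `∫Σ_k‖GB e_k‖² ≤ 3π ⇒ ∫Σ_k‖GB e_k‖² = 0`.
HONEST SCOPE.  Real analysis on `ℝ²` only; the two rows are HYPOTHESES here (bricks W-TWO ∕ W-EN of ROAD (W), not yet in the
tree); nothing of (GAP), (TM), S1″, K1, `BlockLipschitzL`, `HistoryTailL` is proved by this file.  YM₃ on T³ is rung R3, not Clay;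
YM gap NOT proved; no summit statement is proved here.

References: H. Wente (1969); H. Brezis, J.-M. Coron, ARMA 89 (1985) [BrezisCoron1985] (App. Lemma A.1 — the fact this road
avoids); P. Topping, Comment. Math. Helv. 72 (1997) [Topping1997] (the constant `1∕2π`); F. Hélein (2002) [Helein2002] §3.1.
-/

set_option autoImplicit false

noncomputable section

open MeasureTheory Set Function Filter Topology
open scoped ENNReal BigOperators

namespace Summit.QuantumFields.YangMills.Theorems.PoincareLipschitzHSystemGapAlgebra

open Summit.QuantumFields.YangMills.Theorems.PoincareLipschitzHSystemGapAlgebraLetters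

/-! ## §4 The real-number endgame and the `H`-system gap from the two analytic rows -/

/-- Real-number endgame of the cubic chain: with `Θ = x + y + z`, `x, y, z ≥ 0`, `Θ ≤ 3π`, pair products
`s₀² = yz`, `s₁² = zx`, `s₂² = xy`, `D_a ≤ P_a ≤ s_a` and `Θ ≤ (1∕π)(s₀D₀ + s₁D₁ + s₂D₂)`: either `Θ = 0`, or
`Θ = 3π` with `x = y = z = π` and `D_a = P_a = π` for every `a`. [folklore] -/
theorem chain_endgame (Θ x y z s₀ s₁ s₂ D₀ D₁ D₂ P₀ P₁ P₂ : ℝ)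
    (hΘ : Θ = x + y + z) (hx : 0 ≤ x) (hy : 0 ≤ y) (hz : 0 ≤ z) (hcap : Θ ≤ 3 * Real.pi)
    (hs₀ : 0 ≤ s₀) (hs₁ : 0 ≤ s₁) (hs₂ : 0 ≤ s₂) (hs₀2 : s₀ ^ 2 = y * z) (hs₁2 : s₁ ^ 2 = z * x) (hs₂2 : s₂ ^ 2 = x * y)
    (hDP₀ : D₀ ≤ P₀) (hDP₁ : D₁ ≤ P₁) (hDP₂ : D₂ ≤ P₂)
    (hPs₀ : P₀ ≤ s₀) (hPs₁ : P₁ ≤ s₁) (hPs₂ : P₂ ≤ s₂)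
    (hchain : Θ ≤ 1 / Real.pi * (s₀ * D₀ + s₁ * D₁ + s₂ * D₂)) :
    Θ = 0 ∨ (Θ = 3 * Real.pi ∧ x = Real.pi ∧ y = Real.pi ∧ z = Real.pi ∧
      D₀ = Real.pi ∧ D₁ = Real.pi ∧ D₂ = Real.pi ∧ P₀ = Real.pi ∧ P₁ = Real.pi ∧ P₂ = Real.pi) := by
  have hπ : 0 < Real.pi := Real.pi_pos
  have hΘ0 : 0 ≤ Θ := by rw [hΘ]; positivity
  -- termwise `s_a D_a ≤ s_a²`
  have ht₀ : s₀ * D₀ ≤ s₀ ^ 2 := by rw [sq]; exact mul_le_mul_of_nonneg_left (hDP₀.trans hPs₀) hs₀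
  have ht₁ : s₁ * D₁ ≤ s₁ ^ 2 := by rw [sq]; exact mul_le_mul_of_nonneg_left (hDP₁.trans hPs₁) hs₁
  have ht₂ : s₂ * D₂ ≤ s₂ ^ 2 := by rw [sq]; exact mul_le_mul_of_nonneg_left (hDP₂.trans hPs₂) hs₂
  have hsum : s₀ * D₀ + s₁ * D₁ + s₂ * D₂ ≤ y * z + z * x + x * y := by linarith
  have hamgm := three_mul_pair_sum_le_sq x y z
  -- `π Θ ≤ Σ s_a D_a ≤ yz + zx + xy ≤ Θ² / 3`
  have h1 : Real.pi * Θ ≤ s₀ * D₀ + s₁ * D₁ + s₂ * D₂ := by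
    have := mul_le_mul_of_nonneg_left hchain hπ.le
    rwa [← mul_assoc, mul_one_div_cancel hπ.ne', one_mul] at this
  have h2 : 3 * Real.pi * Θ ≤ Θ ^ 2 := by
    have : 3 * (Real.pi * Θ) ≤ (x + y + z) ^ 2 := by linarith
    rw [← hΘ] at this; linarith
  by_cases hlt : Θ < 3 * Real.pi
  · left
    rcases hΘ0.lt_or_eq with hpos | hzero
    · exfalso
      have h3 : 3 * Real.pi * Θ ≤ Θ * Θ := by rw [← sq]; exact h2
      have : 3 * Real.pi ≤ Θ := le_of_mul_le_mul_right h3 hpos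
      linarith
    · exact hzero.symm
  · right
    have hΘeq : Θ = 3 * Real.pi := le_antisymm hcap (not_lt.mp hlt)
    -- all inequalities are equalities
    have hΘsq : Θ ^ 2 = 3 * Real.pi * Θ := by rw [hΘeq]; ring
    have e1 : s₀ * D₀ + s₁ * D₁ + s₂ * D₂ = y * z + z * x + x * y := by
      apply le_antisymm hsum
      have : (x + y + z) ^ 2 ≤ 3 * (Real.pi * Θ) := by rw [← hΘ]; linarith
      linarith
    have e2 : 3 * (y * z + z * x + x * y) = (x + y + z) ^ 2 := by
      apply le_antisymm hamgm
      have : (x + y + z) ^ 2 ≤ 3 * (Real.pi * Θ) := by rw [← hΘ]; linarith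
      linarith
    obtain ⟨hxy, hyz⟩ := eq_of_three_mul_pair_sum_eq_sq x y z e2
    have hxπ : x = Real.pi := by
      have : x + y + z = 3 * Real.pi := by rw [← hΘ]; exact hΘeq
      rw [← hxy] at hyz; rw [← hyz, ← hxy] at this; linarith
    have hyπ : y = Real.pi := by rw [← hxy]; exact hxπ
    have hzπ : z = Real.pi := by rw [← hyz, ← hxy]; exact hxπ
    have hsq_eq : ∀ s : ℝ, 0 ≤ s → s ^ 2 = Real.pi * Real.pi → s = Real.pi := by
      intro s hs h
      have h' : (s - Real.pi) * (s + Real.pi) = 0 := by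
        have hring : (s - Real.pi) * (s + Real.pi) = s ^ 2 - Real.pi * Real.pi := by ring
        rw [hring, h, sub_self]
      rcases mul_eq_zero.mp h' with h'' | h''
      · linarith
      · linarith
    have hs₀π : s₀ = Real.pi := hsq_eq s₀ hs₀ (by rw [hs₀2, hyπ, hzπ])
    have hs₁π : s₁ = Real.pi := hsq_eq s₁ hs₁ (by rw [hs₁2, hzπ, hxπ])
    have hs₂π : s₂ = Real.pi := hsq_eq s₂ hs₂ (by rw [hs₂2, hxπ, hyπ])
    have e1' : Real.pi * (D₀ + D₁ + D₂) = Real.pi * (3 * Real.pi) := by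
      rw [hs₀π, hs₁π, hs₂π, hxπ, hyπ, hzπ] at e1
      linear_combination e1
    have hsumD : D₀ + D₁ + D₂ = 3 * Real.pi := mul_left_cancel₀ hπ.ne' e1'
    rw [hs₀π] at hPs₀
    rw [hs₁π] at hPs₁
    rw [hs₂π] at hPs₂
    have hD₀π : D₀ = Real.pi := by linarith
    have hD₁π : D₁ = Real.pi := by linarith
    have hD₂π : D₂ = Real.pi := by linarith
    exact ⟨hΘeq, hxπ, hyπ, hzπ, hD₀π, hD₁π, hD₂π, by linarith, by linarith, by linarith⟩

/-- **(W-ALG) The `H`-system energy gap at `3π` from the two analytic rows.**  Let `B : ℝ² → ℝ³` be measurable with a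
measurable Jacobian field `GB` of integrable energy density `Σ_k ‖GB e_k‖²`, and write `∂_k B^a := (GB y (e k)) a`,
`‖∇B^a‖₂² := ∫ Σ_k (∂_k B^a)²`, `f_a := ∂₀B^{a+1}∂₁B^{a+2} − ∂₀B^{a+2}∂₁B^{a+1}` (indices in `Fin 3`).  ASSUME the two rows of
ROAD (W): (W-OSC) the sharp two-point Wente oscillation bound `|B^a − c_a| ≤ (1∕2π)‖∇B^{a+1}‖₂‖∇B^{a+2}‖₂` a.e., for some
constants `c : Fin 3 → ℝ`, and (W-EN) the energy bound `∫Σ_k‖GB e_k‖² ≤ 2 Σ_a |∫ (B^a − c_a) f_a|` (the tested weak `H`-system).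
THEN `∫Σ_k‖GB e_k‖² ≤ 3π` forces `∫Σ_k‖GB e_k‖² = 0`.  Proof: Hadamard + Cauchy–Schwarz give
`|∫(B^a−c_a)f_a| ≤ (1∕2π)‖∇B^j‖₂‖∇B^k‖₂ · ∫|f_a| ≤ (1∕2π)(‖∇B^j‖₂‖∇B^k‖₂)²`, so `Θ ≤ (1∕π)Σ_{pairs}‖∇B^j‖₂²‖∇B^k‖₂² ≤ Θ²∕(3π)`
(`chain_endgame`): `Θ = 0` or `Θ = 3π` with equality throughout; in the latter case `|f_a| = |∇B^j||∇B^k|` and `|∇B^j| = |∇B^k|`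
a.e. for all pairs, whence (`dot_eq_zero_of_abs_det_eq`, `sq_norm_eq_zero_of_three_orthogonal`) `∇B = 0` a.e. and `Θ = 0 ≠ 3π`.
[cite: Topping1997, Theorem 1 (the constant 1∕2π behind row (W-OSC)); BrezisCoron1985, Appendix Lemma A.1 (the 8π quantisation this elementary gap replaces below 3π)] -/
theorem energy_zero_of_osc_of_energyBound
    {B : EuclideanSpace ℝ (Fin 2) → EuclideanSpace ℝ (Fin 3)}
    {GB : EuclideanSpace ℝ (Fin 2) → (EuclideanSpace ℝ (Fin 2) →L[ℝ] EuclideanSpace ℝ (Fin 3))}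
    {c : Fin 3 → ℝ}
    (hGm : AEStronglyMeasurable GB volume)
    (hE : Integrable (fun y => ∑ k : Fin 2, ‖GB y (EuclideanSpace.single k (1:ℝ))‖ ^ 2))
    (hOsc : ∀ a : Fin 3, ∀ᵐ y : EuclideanSpace ℝ (Fin 2), |B y a - c a| ≤ 1 / (2 * Real.pi) *
        (Real.sqrt (∫ y, ∑ k : Fin 2, ((GB y (EuclideanSpace.single k (1:ℝ))) (a + 1)) ^ 2) *
         Real.sqrt (∫ y, ∑ k : Fin 2, ((GB y (EuclideanSpace.single k (1:ℝ))) (a + 2)) ^ 2)))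
    (hEn : ∫ y, ∑ k : Fin 2, ‖GB y (EuclideanSpace.single k (1:ℝ))‖ ^ 2 ≤
        2 * ∑ a : Fin 3, |∫ y, (B y a - c a) *
          ((GB y (EuclideanSpace.single 0 (1:ℝ))) (a + 1) * (GB y (EuclideanSpace.single 1 (1:ℝ))) (a + 2) -
           (GB y (EuclideanSpace.single 0 (1:ℝ))) (a + 2) * (GB y (EuclideanSpace.single 1 (1:ℝ))) (a + 1))|)
    (hΘ : ∫ y, ∑ k : Fin 2, ‖GB y (EuclideanSpace.single k (1:ℝ))‖ ^ 2 ≤ 3 * Real.pi) :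
    ∫ y, ∑ k : Fin 2, ‖GB y (EuclideanSpace.single k (1:ℝ))‖ ^ 2 = 0 := by
  have hπ : 0 < Real.pi := Real.pi_pos
  -- specialise the rows to the three concrete indices
  have hO0 := hOsc 0
  have hO1 := hOsc 1
  have hO2 := hOsc 2
  have hEn' := hEn
  simp only [Fin.sum_univ_three, fin3_zero_add_one, fin3_zero_add_two, fin3_one_add_one, fin3_one_add_two,
    fin3_two_add_one, fin3_two_add_two] at hO0 hO1 hO2 hEn'
  -- the three tested terms
  have hT0 := abs_integral_osc_mul_det_le (B := B) hGm hE 0 1 2 hO0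
  have hT1 := abs_integral_osc_mul_det_le (B := B) hGm hE 1 2 0 hO1
  have hT2 := abs_integral_osc_mul_det_le (B := B) hGm hE 2 0 1 hO2
  -- the endgame
  have hend := chain_endgame (∫ y, ∑ k : Fin 2, ‖GB y (EuclideanSpace.single k (1:ℝ))‖ ^ 2)
    (∫ y, ∑ k : Fin 2, ((GB y (EuclideanSpace.single k (1:ℝ))) 0) ^ 2)
    (∫ y, ∑ k : Fin 2, ((GB y (EuclideanSpace.single k (1:ℝ))) 1) ^ 2)
    (∫ y, ∑ k : Fin 2, ((GB y (EuclideanSpace.single k (1:ℝ))) 2) ^ 2)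
    (Real.sqrt (∫ y, ∑ k : Fin 2, ((GB y (EuclideanSpace.single k (1:ℝ))) 1) ^ 2) *
      Real.sqrt (∫ y, ∑ k : Fin 2, ((GB y (EuclideanSpace.single k (1:ℝ))) 2) ^ 2))
    (Real.sqrt (∫ y, ∑ k : Fin 2, ((GB y (EuclideanSpace.single k (1:ℝ))) 2) ^ 2) *
      Real.sqrt (∫ y, ∑ k : Fin 2, ((GB y (EuclideanSpace.single k (1:ℝ))) 0) ^ 2))
    (Real.sqrt (∫ y, ∑ k : Fin 2, ((GB y (EuclideanSpace.single k (1:ℝ))) 0) ^ 2) *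
      Real.sqrt (∫ y, ∑ k : Fin 2, ((GB y (EuclideanSpace.single k (1:ℝ))) 1) ^ 2))
    (∫ y, |(GB y (EuclideanSpace.single 0 (1:ℝ))) 1 * (GB y (EuclideanSpace.single 1 (1:ℝ))) 2 -
        (GB y (EuclideanSpace.single 0 (1:ℝ))) 2 * (GB y (EuclideanSpace.single 1 (1:ℝ))) 1|)
    (∫ y, |(GB y (EuclideanSpace.single 0 (1:ℝ))) 2 * (GB y (EuclideanSpace.single 1 (1:ℝ))) 0 -
        (GB y (EuclideanSpace.single 0 (1:ℝ))) 0 * (GB y (EuclideanSpace.single 1 (1:ℝ))) 2|)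
    (∫ y, |(GB y (EuclideanSpace.single 0 (1:ℝ))) 0 * (GB y (EuclideanSpace.single 1 (1:ℝ))) 1 -
        (GB y (EuclideanSpace.single 0 (1:ℝ))) 1 * (GB y (EuclideanSpace.single 1 (1:ℝ))) 0|)
    (∫ y, Real.sqrt (∑ i : Fin 2, ((GB y (EuclideanSpace.single i (1:ℝ))) 1) ^ 2) *
        Real.sqrt (∑ i : Fin 2, ((GB y (EuclideanSpace.single i (1:ℝ))) 2) ^ 2))
    (∫ y, Real.sqrt (∑ i : Fin 2, ((GB y (EuclideanSpace.single i (1:ℝ))) 2) ^ 2) *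
        Real.sqrt (∑ i : Fin 2, ((GB y (EuclideanSpace.single i (1:ℝ))) 0) ^ 2))
    (∫ y, Real.sqrt (∑ i : Fin 2, ((GB y (EuclideanSpace.single i (1:ℝ))) 0) ^ 2) *
        Real.sqrt (∑ i : Fin 2, ((GB y (EuclideanSpace.single i (1:ℝ))) 1) ^ 2))
    (energy_eq_sum_gradEnergy hGm hE) (gradEnergy_nonneg GB 0) (gradEnergy_nonneg GB 1) (gradEnergy_nonneg GB 2) hΘ
    (by positivity) (by positivity) (by positivity)
    (by rw [mul_pow, Real.sq_sqrt (gradEnergy_nonneg GB 1), Real.sq_sqrt (gradEnergy_nonneg GB 2)])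
    (by rw [mul_pow, Real.sq_sqrt (gradEnergy_nonneg GB 2), Real.sq_sqrt (gradEnergy_nonneg GB 0)])
    (by rw [mul_pow, Real.sq_sqrt (gradEnergy_nonneg GB 0), Real.sq_sqrt (gradEnergy_nonneg GB 1)])
    (integral_abs_det_le hGm hE 1 2) (integral_abs_det_le hGm hE 2 0) (integral_abs_det_le hGm hE 0 1)
    (integral_gradNorm_mul_le hGm hE 1 2) (integral_gradNorm_mul_le hGm hE 2 0) (integral_gradNorm_mul_le hGm hE 0 1)
    (by
      have hrw : ∀ u w : ℝ, 2 * (1 / (2 * Real.pi) * u * w) = 1 / Real.pi * (u * w) := by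
        intro u w; field_simp
      linarith [hEn', hT0, hT1, hT2,
        hrw (Real.sqrt (∫ y, ∑ k : Fin 2, ((GB y (EuclideanSpace.single k (1:ℝ))) 1) ^ 2) *
          Real.sqrt (∫ y, ∑ k : Fin 2, ((GB y (EuclideanSpace.single k (1:ℝ))) 2) ^ 2))
          (∫ y, |(GB y (EuclideanSpace.single 0 (1:ℝ))) 1 * (GB y (EuclideanSpace.single 1 (1:ℝ))) 2 -
            (GB y (EuclideanSpace.single 0 (1:ℝ))) 2 * (GB y (EuclideanSpace.single 1 (1:ℝ))) 1|),
        hrw (Real.sqrt (∫ y, ∑ k : Fin 2, ((GB y (EuclideanSpace.single k (1:ℝ))) 2) ^ 2) *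
          Real.sqrt (∫ y, ∑ k : Fin 2, ((GB y (EuclideanSpace.single k (1:ℝ))) 0) ^ 2))
          (∫ y, |(GB y (EuclideanSpace.single 0 (1:ℝ))) 2 * (GB y (EuclideanSpace.single 1 (1:ℝ))) 0 -
            (GB y (EuclideanSpace.single 0 (1:ℝ))) 0 * (GB y (EuclideanSpace.single 1 (1:ℝ))) 2|),
        hrw (Real.sqrt (∫ y, ∑ k : Fin 2, ((GB y (EuclideanSpace.single k (1:ℝ))) 0) ^ 2) *
          Real.sqrt (∫ y, ∑ k : Fin 2, ((GB y (EuclideanSpace.single k (1:ℝ))) 1) ^ 2))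
          (∫ y, |(GB y (EuclideanSpace.single 0 (1:ℝ))) 0 * (GB y (EuclideanSpace.single 1 (1:ℝ))) 1 -
            (GB y (EuclideanSpace.single 0 (1:ℝ))) 1 * (GB y (EuclideanSpace.single 1 (1:ℝ))) 0|)])
  rcases hend with hzero | ⟨hΘeq, hx, hy, hz, hD₀, hD₁, hD₂, hP₀, hP₁, hP₂⟩
  · exact hzero
  -- the equality case `Θ = 3π` is impossible
  exfalso
  have a0 := ae_abs_det_eq_of_integral_eq hGm hE 1 2 (hD₀.trans hP₀.symm)
  have a1 := ae_abs_det_eq_of_integral_eq hGm hE 2 0 (hD₁.trans hP₁.symm)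
  have a2 := ae_abs_det_eq_of_integral_eq hGm hE 0 1 (hD₂.trans hP₂.symm)
  have b0 := ae_gradNorm_eq_of_integral_eq hGm hE 1 2 hy hz hP₀
  have b1 := ae_gradNorm_eq_of_integral_eq hGm hE 2 0 hz hx hP₁
  -- pointwise: three pairwise-orthogonal gradients of equal length vanish
  have hae0 : ∀ᵐ y : EuclideanSpace ℝ (Fin 2), ∑ k : Fin 2, ‖GB y (EuclideanSpace.single k (1:ℝ))‖ ^ 2 = 0 := by
    filter_upwards [a0, a1, a2, b0, b1] with y h0 h1 h2 e0 e1
    simp only [Fin.sum_univ_two] at h0 h1 h2 e0 e1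
    have d12 := dot_eq_zero_of_abs_det_eq _ _ _ _ h0
    have d20 := dot_eq_zero_of_abs_det_eq _ _ _ _ h1
    have d01 := dot_eq_zero_of_abs_det_eq _ _ _ _ h2
    have n12 : (GB y (EuclideanSpace.single 0 (1:ℝ))) 1 ^ 2 + (GB y (EuclideanSpace.single 1 (1:ℝ))) 1 ^ 2 =
        (GB y (EuclideanSpace.single 0 (1:ℝ))) 2 ^ 2 + (GB y (EuclideanSpace.single 1 (1:ℝ))) 2 ^ 2 := by
      have := congrArg (fun t : ℝ => t ^ 2) e0
      simpa only [Real.sq_sqrt (add_nonneg (sq_nonneg _) (sq_nonneg _))] using this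
    have n20 : (GB y (EuclideanSpace.single 0 (1:ℝ))) 2 ^ 2 + (GB y (EuclideanSpace.single 1 (1:ℝ))) 2 ^ 2 =
        (GB y (EuclideanSpace.single 0 (1:ℝ))) 0 ^ 2 + (GB y (EuclideanSpace.single 1 (1:ℝ))) 0 ^ 2 := by
      have := congrArg (fun t : ℝ => t ^ 2) e1
      simpa only [Real.sq_sqrt (add_nonneg (sq_nonneg _) (sq_nonneg _))] using this
    have key := sq_norm_eq_zero_of_three_orthogonal
      ((GB y (EuclideanSpace.single 0 (1:ℝ))) 0) ((GB y (EuclideanSpace.single 1 (1:ℝ))) 0)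
      ((GB y (EuclideanSpace.single 0 (1:ℝ))) 1) ((GB y (EuclideanSpace.single 1 (1:ℝ))) 1)
      ((GB y (EuclideanSpace.single 0 (1:ℝ))) 2) ((GB y (EuclideanSpace.single 1 (1:ℝ))) 2)
      d01 d12 (by linarith [d20]) (by linarith [n12, n20]) n20
    rw [Fin.sum_univ_two, norm_sq_eq_sum_sq_fin_three, norm_sq_eq_sum_sq_fin_three, Fin.sum_univ_three, Fin.sum_univ_three]
    linarith [n12, n20, key]
  have hΘ0 : ∫ y, ∑ k : Fin 2, ‖GB y (EuclideanSpace.single k (1:ℝ))‖ ^ 2 = 0 :=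
    integral_eq_zero_of_ae hae0
  rw [hΘ0] at hΘeq
  linarith

end Summit.QuantumFields.YangMills.Theorems.PoincareLipschitzHSystemGapAlgebra

end
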